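import Summits.CriticalPhenomena.PercolationContinuityZ3.Theorems.PercNearOneGluingNoHeavyLowerTailSahiE3LroLayers
import Mathlib.Tactic.Linarith
import Mathlib.Tactic.Ring
import Mathlib.Tactic.Positivity
import HarnessLib
import HarnessLib.Audit

/-!
# `NoHeavyLowerTail` (crux stmt-CriticalPhenomena-4575), Sahi programme P4 (Holley / monotone coupling):
# linear read-once slots, file 2 — the OR-step of the attribution certificate

Support file (cell `prim-l12`, seat P4, generation 11; `--supports stmt-CriticalPhenomena-4575`).  No named facts, no sorries;
standard axioms; def-free.

A flow certificate in the sense of `…SahiE3PatternCertificate.phi_nonneg_of_patternCertificate` ((R0), (F0), (F≤), (cap),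
(K), (pair)) with EXACT deliveries ((K) with equality) for a slot `G ⊆ Q` and a weight `ν'` on a finite poset `Q` satisfying
Harris' inequality for up-sets is lifted to the slot `{(b, t) | b = true ∨ t ∈ G}` ("`x ∨ G`") of `Bool × Q` with the layered
product weight `ν(true, t) = p ν'(t)`, `ν(false, t) = q ν'(t)`: THEOREM `cert_or_step`.  The certificate is the ATTRIBUTION
certificate (a receiver `(false, s)` is served vertically by `(true, s)` with the exact amount `(p+q)Z'²·p·q·ν'(s)` and by the
`G`-certificate scaled by `(p+q)q²`); its pair inequality is the explicit sum-of-products identity recorded in the docstring,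
whose ingredients are the inner pair inequality, three instances of Harris on `Q`, modularity of `ν'`, and
`(ν'(S₁) − ν'(S₀))(ν'(S₁') − ν'(S₀')) ≥ 0` for the layers `S₀ ⊆ S₁` of an up-set.  With the AND-step (`…SahiE3LroAndStep`)
and induction along a linear read-once formula `x₁ ∘₁ (x₂ ∘₂ (⋯ x_k))` this yields Kahn's Conjecture 5 for every linear
read-once first slot under product measures (HOME prim-l12-p4/FROM-prim-l12-p4-gen11-LRO-SLOTS.md).
-/

namespace Summit.CriticalPhenomena.PercolationContinuityZ3.Theorems.SahiE3LroOrStep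

open Finset SahiE3LroLayers
open scoped BigOperators

variable {Q : Type*} [Fintype Q] [DecidableEq Q] [PartialOrder Q]

/-! ## The OR-step -/

omit [PartialOrder Q] in
/-- Layers of the slot `U = {(b, t) | b = true ∨ t ∈ G}` and of its complement, and of intersections with it. [this work] -/
theorem layers_orSlot (G : Finset Q) (U : Finset (Bool × Q)) (hU : ∀ x, x ∈ U ↔ (x.1 = true ∨ x.2 ∈ G))
    (X : Finset (Bool × Q)) :
    univ.filter (fun t => (true, t) ∈ X ∩ U) = univ.filter (fun t => (true, t) ∈ X) ∧
    univ.filter (fun t => (false, t) ∈ X ∩ U) = univ.filter (fun t => (false, t) ∈ X) ∩ G ∧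
    univ.filter (fun t => (true, t) ∈ Uᶜ) = ∅ ∧
    univ.filter (fun t => (false, t) ∈ Uᶜ) = Gᶜ ∧
    univ.filter (fun t => (true, t) ∈ U) = univ ∧
    univ.filter (fun t => (false, t) ∈ U) = G := by
  refine ⟨?_, ?_, ?_, ?_, ?_, ?_⟩ <;> ext t <;> simp [hU]

omit [PartialOrder Q] in
/-- Layers of an intersection. [folklore] -/
theorem layers_inter (X Y : Finset (Bool × Q)) (b : Bool) :
    univ.filter (fun t => (b, t) ∈ X ∩ Y) = univ.filter (fun t => (b, t) ∈ X) ∩ univ.filter (fun t => (b, t) ∈ Y) := by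
  ext t; simp

/-- **OR-step of the linear read-once certificate.**  Let `ν' ≥ 0` on a finite poset `Q` satisfy Harris' inequality for up-sets,
`G ⊆ Q` an up-set (the slot of the inner formula) with a flow certificate `(R', Fl')` with EXACT deliveries for the weight `ν'`
(conditions (R0), (F0), (F≤), (cap), (K) with equality, (pair) of `…SahiE3PatternCertificate.phi_nonneg_of_patternCertificate`).
Then the slot `U = {(b,t) | b = true ∨ t ∈ G}` ("`x ∨ G`") of `Bool × Q` with the layered product weight
`ν(true, t) = p·ν'(t)`, `ν(false, t) = q·ν'(t)` (`p, q ≥ 0`) carries a flow certificate with exact deliveries: the attribution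
certificate (a receiver `(false, s)` is served by `(true, s)` with the fraction `p Z'/N_U` and by the `G`-certificate scaled by `q²`
otherwise).  The pair inequality is the identity
`RHS − LHS = (p+q)q²·[pair'] + p(p+q)(pZ'+qN'_D)·[Harris] + pq(p+q)Z'·([Harris] + [Harris]) + pq(p+q)Z'²·[modularity] + pq²N'_D·(s₁−s₀)(s₁'−s₀')`. [this work] -/
theorem cert_or_step {ν' : Q → ℝ} (hν' : ∀ t, 0 ≤ ν' t)
    (hH : ∀ S S' : Finset Q, IsUpperSet (S : Set Q) → IsUpperSet (S' : Set Q) →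
      (∑ t ∈ S, ν' t) * (∑ t ∈ S', ν' t) ≤ (∑ t, ν' t) * ∑ t ∈ S ∩ S', ν' t)
    (G : Finset Q) (hG : IsUpperSet (G : Set Q)) (R' : Q → ℝ) (Fl' : Q → Q → ℝ)
    (hR'0 : ∀ t ∈ G, 0 ≤ R' t) (hF'0 : ∀ t s, 0 ≤ Fl' t s) (hF'le : ∀ t s, Fl' t s ≠ 0 → s ≤ t)
    (hcap' : ∀ t ∈ G, R' t + ∑ s ∈ Gᶜ, Fl' t s ≤ (∑ r, ν' r) * ((∑ r, ν' r) + ∑ r ∈ Gᶜ, ν' r) * ν' t)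
    (hK' : ∀ s ∈ Gᶜ, ∑ t ∈ G, Fl' t s = (∑ r, ν' r) * (∑ r ∈ G, ν' r) * ν' s)
    (hpair' : ∀ S S' : Finset Q, IsUpperSet (S : Set Q) → IsUpperSet (S' : Set Q) →
      (∑ r, ν' r) * ((∑ t ∈ S, ν' t) * (∑ t ∈ S' ∩ G, ν' t) + (∑ t ∈ S', ν' t) * (∑ t ∈ S ∩ G, ν' t))
          - (∑ r ∈ G, ν' r) * (∑ t ∈ S, ν' t) * (∑ t ∈ S', ν' t) ≤ ∑ t ∈ (S ∩ S') ∩ G, R' t)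
    {p q : ℝ} (hp : 0 ≤ p) (hq : 0 ≤ q) (ν : Bool × Q → ℝ) (hνt : ∀ t, ν (true, t) = p * ν' t)
    (hνf : ∀ t, ν (false, t) = q * ν' t) (U : Finset (Bool × Q)) (hU : ∀ x, x ∈ U ↔ (x.1 = true ∨ x.2 ∈ G)) :
    ∃ (R : Bool × Q → ℝ) (Fl : (Bool × Q) → (Bool × Q) → ℝ),
      (∀ t ∈ U, 0 ≤ R t) ∧ (∀ t s, 0 ≤ Fl t s) ∧ (∀ t s, Fl t s ≠ 0 → s ≤ t) ∧
      (∀ t ∈ U, R t + ∑ s ∈ Uᶜ, Fl t s ≤ (∑ r, ν r) * ((∑ r, ν r) + ∑ r ∈ Uᶜ, ν r) * ν t) ∧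
      (∀ s ∈ Uᶜ, ∑ t ∈ U, Fl t s = (∑ r, ν r) * (∑ r ∈ U, ν r) * ν s) ∧
      (∀ S S' : Finset (Bool × Q), IsUpperSet (S : Set (Bool × Q)) → IsUpperSet (S' : Set (Bool × Q)) →
        (∑ r, ν r) * ((∑ t ∈ S, ν t) * (∑ t ∈ S' ∩ U, ν t) + (∑ t ∈ S', ν t) * (∑ t ∈ S ∩ U, ν t))
            - (∑ r ∈ U, ν r) * (∑ t ∈ S, ν t) * (∑ t ∈ S', ν t) ≤ ∑ t ∈ (S ∩ S') ∩ U, R t) := by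
  have LcT := (layers_orSlot G U hU U).2.2.1
  have LcF := (layers_orSlot G U hU U).2.2.2.1
  have LuT := (layers_orSlot G U hU U).2.2.2.2.1
  have LuF := (layers_orSlot G U hU U).2.2.2.2.2
  obtain ⟨Z', hZ'⟩ : ∃ x : ℝ, ∑ t, ν' t = x := ⟨_, rfl⟩
  obtain ⟨NG, hNG⟩ : ∃ x : ℝ, ∑ t ∈ G, ν' t = x := ⟨_, rfl⟩
  obtain ⟨ND, hND⟩ : ∃ x : ℝ, ∑ t ∈ Gᶜ, ν' t = x := ⟨_, rfl⟩
  have hsplit : Z' = NG + ND := by rw [← hZ', ← hNG, ← hND]; exact (Finset.sum_add_sum_compl G ν').symm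
  have hZ'0 : 0 ≤ Z' := hZ' ▸ Finset.sum_nonneg fun t _ => hν' t
  have hNG0 : 0 ≤ NG := hNG ▸ Finset.sum_nonneg fun t _ => hν' t
  have hND0 : 0 ≤ ND := hND ▸ Finset.sum_nonneg fun t _ => hν' t
  rw [hZ'] at hH; rw [hZ', hND] at hcap'; rw [hZ', hNG] at hK' hpair'
  -- layer sums of `ν`
  have lay : ∀ X : Finset (Bool × Q), ∑ x ∈ X, ν x =
      p * ∑ t ∈ univ.filter (fun t => (true, t) ∈ X), ν' t + q * ∑ t ∈ univ.filter (fun t => (false, t) ∈ X), ν' t := by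
    intro X
    rw [sum_layers, Finset.mul_sum, Finset.mul_sum]
    exact congrArg₂ (· + ·) (Finset.sum_congr rfl fun t _ => hνt t) (Finset.sum_congr rfl fun t _ => hνf t)
  have eZ : ∑ x, ν x = (p + q) * Z' := by
    rw [sum_layers_univ, show ∑ t, ν (true, t) = p * ∑ t, ν' t by
        rw [Finset.mul_sum]; exact Finset.sum_congr rfl fun t _ => hνt t,
      show ∑ t, ν (false, t) = q * ∑ t, ν' t by
        rw [Finset.mul_sum]; exact Finset.sum_congr rfl fun t _ => hνf t, hZ']
    ring
  have eU : ∑ x ∈ U, ν x = p * Z' + q * NG := by rw [lay U, LuT, LuF, hZ', hNG]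
  have eUc : ∑ x ∈ Uᶜ, ν x = q * ND := by rw [lay Uᶜ, LcT, LcF, Finset.sum_empty, mul_zero, zero_add, hND]
  -- the certificate
  refine ⟨fun x => if x.1 = true then p * ν' x.2 * ((p + q) * Z') * ((p + q) * Z' + q * ND - (if x.2 ∈ G then 0 else q * Z'))
      else (p + q) * q * (p * Z' ^ 2 * ν' x.2 + q * R' x.2),
    fun x y => if y.1 = true then 0 else if x.1 = true then (if x.2 = y.2 then (if y.2 ∈ G then 0 else
      (p + q) * Z' ^ 2 * p * q * ν' y.2) else 0) else (p + q) * q ^ 2 * Fl' x.2 y.2, ?_, ?_, ?_, ?_, ?_, ?_⟩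
  · -- (R0)
    rintro ⟨b, t⟩ hx
    have hνt0 := hν' t
    cases b
    · have ht : t ∈ G := by simpa using (hU (false, t)).1 hx
      have := hR'0 t ht
      simp only [Bool.false_eq_true, ↓reduceIte]
      positivity
    · simp only [↓reduceIte]
      have h1 : 0 ≤ (p + q) * Z' + q * ND - (if t ∈ G then 0 else q * Z') := by
        split_ifs <;> nlinarith [mul_nonneg hp hZ'0, mul_nonneg hq hND0, mul_nonneg hq hZ'0]
      exact mul_nonneg (by positivity) h1
  · -- (F0)
    rintro ⟨b, t⟩ ⟨b', s⟩
    have := hF'0 t s; have := hν' s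
    dsimp only
    split_ifs <;> positivity
  · -- (F≤)
    rintro ⟨b, t⟩ ⟨b', s⟩ h
    dsimp only at h
    cases b' <;> cases b <;> simp only [Bool.false_eq_true, ↓reduceIte, ne_eq, not_true_eq_false] at h ⊢
    · exact ⟨le_rfl, hF'le t s (by intro h0; exact h (by rw [h0, mul_zero]))⟩
    · by_cases hts : t = s
      · subst hts; exact ⟨Bool.false_le _, le_rfl⟩
      · exact absurd (by simp [hts]) h
  · -- (cap)
    rintro ⟨b, t⟩ hx
    have hνt0 := hν' t
    rw [sum_layers, LcT, LcF, Finset.sum_empty, zero_add, eZ, eUc]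
    cases b
    · have ht : t ∈ G := by simpa using (hU (false, t)).1 hx
      simp only [Bool.false_eq_true, ↓reduceIte, hνf]
      rw [← Finset.mul_sum]
      have hc := hcap' t ht
      have hR := hR'0 t ht
      have hFs : 0 ≤ ∑ s ∈ Gᶜ, Fl' t s := Finset.sum_nonneg fun s _ => hF'0 t s
      nlinarith [mul_le_mul_of_nonneg_left hc (by positivity : 0 ≤ (p + q) * q ^ 2), mul_nonneg hp hZ'0,
        mul_nonneg (mul_nonneg (mul_nonneg hp hq) hZ'0) hνt0, mul_nonneg hq hND0]
    · simp only [↓reduceIte, hνt, Bool.false_eq_true]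
      rw [Finset.sum_ite_eq Gᶜ t]
      by_cases htG : t ∈ G
      · have : t ∉ Gᶜ := by simpa using htG
        simp only [htG, this, ↓reduceIte]
        nlinarith [hνt0]
      · have : t ∈ Gᶜ := by simpa using htG
        simp only [htG, this, ↓reduceIte]
        nlinarith [hνt0]
  · -- (K) with equality
    rintro ⟨b, s⟩ hs
    have hs' : b = false ∧ s ∉ G := by simpa [hU] using hs
    obtain ⟨rfl, hsG⟩ := hs'
    rw [sum_layers, LuT, LuF, eZ, eU, hνf]
    simp only [Bool.false_eq_true, ↓reduceIte, hsG]
    rw [Finset.sum_ite_eq' univ s, if_pos (Finset.mem_univ s), ← Finset.mul_sum, hK' s (by simpa using hsG)]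
    ring
  · -- (pair)
    intro S S' hS hS'
    set S1 := univ.filter (fun t => (true, t) ∈ S) with hS1
    set S0 := univ.filter (fun t => (false, t) ∈ S) with hS0
    set T1 := univ.filter (fun t => (true, t) ∈ S') with hT1
    set T0 := univ.filter (fun t => (false, t) ∈ S') with hT0
    have u1 : IsUpperSet (S1 : Set Q) := isUpperSet_layer hS true
    have u0 : IsUpperSet (S0 : Set Q) := isUpperSet_layer hS false
    have v1 : IsUpperSet (T1 : Set Q) := isUpperSet_layer hS' true
    have v0 : IsUpperSet (T0 : Set Q) := isUpperSet_layer hS' false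
    have hGu : IsUpperSet (G : Set Q) := hG
    have u0G : IsUpperSet ((S0 ∩ G : Finset Q) : Set Q) := by rw [Finset.coe_inter]; exact u0.inter hGu
    have v0G : IsUpperSet ((T0 ∩ G : Finset Q) : Set Q) := by rw [Finset.coe_inter]; exact v0.inter hGu
    -- the sums in the goal, in layer form
    have eS : ∑ x ∈ S, ν x = p * ∑ t ∈ S1, ν' t + q * ∑ t ∈ S0, ν' t := lay S
    have eS' : ∑ x ∈ S', ν x = p * ∑ t ∈ T1, ν' t + q * ∑ t ∈ T0, ν' t := lay S'
    have eSU : ∑ x ∈ S ∩ U, ν x = p * ∑ t ∈ S1, ν' t + q * ∑ t ∈ S0 ∩ G, ν' t := by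
      rw [lay, (layers_orSlot G U hU S).1, (layers_orSlot G U hU S).2.1]
    have eS'U : ∑ x ∈ S' ∩ U, ν x = p * ∑ t ∈ T1, ν' t + q * ∑ t ∈ T0 ∩ G, ν' t := by
      rw [lay, (layers_orSlot G U hU S').1, (layers_orSlot G U hU S').2.1]
    have eR : ∑ x ∈ (S ∩ S') ∩ U, (fun x : Bool × Q => if x.1 = true then
        p * ν' x.2 * ((p + q) * Z') * ((p + q) * Z' + q * ND - (if x.2 ∈ G then 0 else q * Z'))
        else (p + q) * q * (p * Z' ^ 2 * ν' x.2 + q * R' x.2)) x =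
        p * ((p + q) * Z') * ((p + q) * Z' + q * ND) * ∑ t ∈ S1 ∩ T1, ν' t
          - p * ((p + q) * Z') * (q * Z') * ∑ t ∈ S1 ∩ T1, (if t ∈ G then 0 else ν' t)
          + ((p + q) * q * (p * Z' ^ 2) * ∑ t ∈ S0 ∩ T0 ∩ G, ν' t + (p + q) * q * q * ∑ t ∈ S0 ∩ T0 ∩ G, R' t) := by
      rw [sum_layers, (layers_orSlot G U hU (S ∩ S')).1, (layers_orSlot G U hU (S ∩ S')).2.1, layers_inter,
        layers_inter]
      simp only [Bool.false_eq_true, ↓reduceIte]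
      rw [← hS1, ← hT1, ← hS0, ← hT0]
      congr 1
      · rw [Finset.mul_sum, Finset.mul_sum, ← Finset.sum_sub_distrib]
        refine Finset.sum_congr rfl fun t _ => ?_
        split_ifs <;> ring
      · rw [Finset.mul_sum, Finset.mul_sum, ← Finset.sum_add_distrib]
        refine Finset.sum_congr rfl fun t _ => ?_
        ring
    -- facts on `Q`
    have hI : ∑ t ∈ S1 ∩ T1, ν' t = ∑ t ∈ S1 ∩ T1 ∩ G, ν' t + ∑ t ∈ S1 ∩ T1, (if t ∈ G then 0 else ν' t) := by
      rw [← Finset.sum_filter_add_sum_filter_not (S1 ∩ T1) (fun t => t ∈ G), Finset.sum_ite,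
        Finset.sum_const_zero, zero_add]
      rfl
    have H1 := hH S1 T1 u1 v1
    have H2 := hH S1 (T0 ∩ G) u1 v0G
    have H3 := hH T1 (S0 ∩ G) v1 u0G
    have H5 := hpair' S0 T0 u0 v0
    have m1 : ∑ t ∈ S0, ν' t ≤ ∑ t ∈ S1, ν' t := sum_le_sum_of_subset' hν' (layer_false_subset_true hS)
    have m2 : ∑ t ∈ T0, ν' t ≤ ∑ t ∈ T1, ν' t := sum_le_sum_of_subset' hν' (layer_false_subset_true hS')
    have hmod : ∑ t ∈ S1 ∩ (T0 ∩ G), ν' t + ∑ t ∈ T1 ∩ (S0 ∩ G), ν' t ≤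
        ∑ t ∈ S1 ∩ T1 ∩ G, ν' t + ∑ t ∈ S0 ∩ T0 ∩ G, ν' t := by
      rw [← Finset.sum_union_inter]
      refine add_le_add (sum_le_sum_of_subset' hν' ?_) (sum_le_sum_of_subset' hν' ?_)
      · intro t ht
        simp only [Finset.mem_union, Finset.mem_inter] at ht ⊢
        rcases ht with ⟨h1, h2, h3⟩ | ⟨h1, h2, h3⟩
        · exact ⟨⟨h1, layer_false_subset_true hS' h2⟩, h3⟩
        · exact ⟨⟨layer_false_subset_true hS h2, h1⟩, h3⟩
      · intro t ht
        simp only [Finset.mem_inter] at ht ⊢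
        exact ⟨⟨ht.2.2.1, ht.1.2.1⟩, ht.1.2.2⟩
    have n3 : 0 ≤ ∑ t ∈ S1 ∩ T1, (if t ∈ G then 0 else ν' t) :=
      Finset.sum_nonneg fun t _ => by split_ifs <;> [exact le_rfl; exact hν' t]
    rw [eZ, eU, eS, eS', eSU, eS'U, eR]
    -- the SOS identity
    have P1 : 0 ≤ p * (p + q) * (p * Z' + q * ND) *
        (Z' * ∑ t ∈ S1 ∩ T1, ν' t - (∑ t ∈ S1, ν' t) * ∑ t ∈ T1, ν' t) :=
      mul_nonneg (by positivity) (sub_nonneg.2 H1)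
    have P2 : 0 ≤ p * q * (p + q) * Z' *
        (Z' * ∑ t ∈ S1 ∩ (T0 ∩ G), ν' t - (∑ t ∈ S1, ν' t) * ∑ t ∈ T0 ∩ G, ν' t) :=
      mul_nonneg (by positivity) (sub_nonneg.2 H2)
    have P3 : 0 ≤ p * q * (p + q) * Z' *
        (Z' * ∑ t ∈ T1 ∩ (S0 ∩ G), ν' t - (∑ t ∈ T1, ν' t) * ∑ t ∈ S0 ∩ G, ν' t) :=
      mul_nonneg (by positivity) (sub_nonneg.2 H3)
    have P4 : 0 ≤ p * q * (p + q) * Z' ^ 2 * (∑ t ∈ S1 ∩ T1 ∩ G, ν' t + ∑ t ∈ S0 ∩ T0 ∩ G, ν' t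
        - (∑ t ∈ S1 ∩ (T0 ∩ G), ν' t + ∑ t ∈ T1 ∩ (S0 ∩ G), ν' t)) :=
      mul_nonneg (by positivity) (sub_nonneg.2 hmod)
    have P5 : 0 ≤ (p + q) * q ^ 2 * (∑ t ∈ S0 ∩ T0 ∩ G, R' t - (Z' * ((∑ t ∈ S0, ν' t) * ∑ t ∈ T0 ∩ G, ν' t
        + (∑ t ∈ T0, ν' t) * ∑ t ∈ S0 ∩ G, ν' t) - NG * (∑ t ∈ S0, ν' t) * ∑ t ∈ T0, ν' t)) :=
      mul_nonneg (by positivity) (sub_nonneg.2 H5)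
    have P6 : 0 ≤ p * q ^ 2 * ND * ((∑ t ∈ S1, ν' t - ∑ t ∈ S0, ν' t) * (∑ t ∈ T1, ν' t - ∑ t ∈ T0, ν' t)) :=
      mul_nonneg (by positivity) (mul_nonneg (sub_nonneg.2 m1) (sub_nonneg.2 m2))
    have hA : (∑ t ∈ S1 ∩ T1, if t ∈ G then (0:ℝ) else ν' t) = ∑ t ∈ S1 ∩ T1, ν' t - ∑ t ∈ S1 ∩ T1 ∩ G, ν' t := by
      linarith [hI]
    rw [hA]
    subst hsplit
    linarith [P1, P2, P3, P4, P5, P6, n3]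



end Summit.CriticalPhenomena.PercolationContinuityZ3.Theorems.SahiE3LroOrStep
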